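import Summits.ValiantsHypothesis.ValiantsHypothesis.Theorems.KPlusLogSqLawTropicalBWalkDesignStructure
import Summits.ValiantsHypothesis.ValiantsHypothesis.Theorems.LacunarySymmetroidMatrixDescartesCensusTropicalKLaw
import Summits.ValiantsHypothesis.ValiantsHypothesis.Theorems.SymmetroidDescartesDerivedPencilRolleStaircase

/-!
# Route `KPlusLogSqLaw`, crux `TropicalB` — walk designs, III: the STAIRCASE as a tropical design; `TropExponentLaw e` is FALSE for every `e`

HONEST FRAMING.  Helper file (negative-side calibration) toward the registered stubs `stub_tropThin` / `stub_tropFat` of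
`Cruxes/TropicalB/Lines/birth.lean` (crux `TropicalB`, ledger item `stmt-ValiantsHypothesis-19771`, route `KPlusLogSqLaw`,
DRAFT; cell `pub-symmetroid`, seat `val-sym-trop-p1`, 2026-08-26).  Nothing here proves any part of a stub; nothing asserts
`TropicalB`, `KPlusLogSqLaw`, `MatrixDescartes` or anything about `VP ≠ VNP`.

THE BRIDGE.  The tree's staircase (`DPR.stub_stair`) speaks the LIST vocabulary of `…DerivedPencilRolleWalkDefs`: a layered
graph `g : List (WLayer V K)`, walks `w : List V` from `v₀`, `walkCost d lam g v₀ w : WithTop ℤ`, `walkSign`.  This file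
converts it to the `Fin`-indexed walk designs of `…TropicalBWalkDesignDefs` (`lay = g.get`):
* `walkCost_ofFn` / `walkSign_ofFn` — for a vertex sequence `y` through present edges, the list walk `List.ofFn (y ∘ succ)`
  has `walkCost = ↑(walkCostFin)` and `walkSign = walkSgnFin`;
* `exists_walk_of_walkCost_ne_top` — a list walk of finite cost comes from such a vertex sequence;
* `natAbs_walkEps_le_one` — the walk design has entries in `{−1, 0, 1}`;
* **`le_of_walkSystem`** — a UNIQUE-WALK SYSTEM (strictly increasing integer slopes `lam j`, walks `w_j` of cost `c_j`, every
  other list costing `≥ c_j + 1`, signs `(−1)^j`, `j ≤ N`) in a layered graph with `T ≥ 1` layers yields a sign-alternating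
  dominant chain of `N + 1` terms of the walk design, so `TropRootLawAt ((T+1)·|V|) K B → N ≤ B`.
THE STAIRCASE (§4).  Applied to the tree's PROVED staircase `DPR.stub_stair` (`n ≥ 2` even, `L ≥ 1`: `n^L` uniquely cheapest
walks with margin `1` at increasing integer slopes and alternating signs, `K = L + 1` classes, `T = (2^L − 1)(n+1)` layers over
`V = Fin (2^L n) × Bool`): `staircase_lower : TropRootLawAt (((2^L − 1)(n+1) + 1)·(2^L·n·2)) (L + 1) B → n^L − 1 ≤ B`; hence
**`not_tropExponentLaw : ∀ e, ¬ TropExponentLaw e`** (`L = 2e + 1`, `n` even and large: the kernel form of the NEGATIVE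
calibration the route records as «dead on paper» in `…CensusTropicalKLaw` — the `log² m` of `TropicalB` / Conjecture B cannot
be traded for `e·log m`) and **`not_tropK4Law_one : ¬ TropK4Law 1`** (`L = 3`: the `K = 4` column is not linearly bounded,
`T(m,4) ≥ c·m^{3/2}`; this says nothing about `TropK4Law 2`).  All [folklore] given the tree's theorems (term-level form of
the tree's WalkSign/WalkDet; the staircase is Carstensen 1983 / Mulmuley–Shah 2001 / blueprint `staircase-refutation`).
-/

set_option linter.dupNamespace false
set_option autoImplicit false

namespace Summit.ValiantsHypothesis.ValiantsHypothesis.Theorems.KPlusLogSqLaw.WalkDesign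

open Summit.ValiantsHypothesis.ValiantsHypothesis.Theorems.MatrixDescartes.Negative
open Summit.ValiantsHypothesis.ValiantsHypothesis.Theorems.LacunarySymmetroidMatrixDescartes.TropicalCensus
open Summit.ValiantsHypothesis.ValiantsHypothesis.Theorems.SymmetroidDescartes.DPR
open scoped BigOperators
open Finset

variable {V : Type*} {K : ℕ} (d : Fin K → ℕ)

/-! ## 1. List walks versus vertex sequences -/

/-- the edge of layer `0` of a cons graph along a vertex sequence. -/
theorem edgeAt_cons_zero (l : WLayer V K) (g : List (WLayer V K)) (y : Fin (g.length + 1 + 1) → V) :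
    edgeAt (l :: g).get y 0 = l (y 0) (y 1) := rfl

/-- the edges of the later layers of a cons graph are the edges of the tail along the shifted sequence. -/
theorem edgeAt_cons_succ (l : WLayer V K) (g : List (WLayer V K)) (y : Fin (g.length + 1 + 1) → V)
    (s : Fin g.length) : edgeAt (l :: g).get y s.succ = edgeAt g.get (fun t => y t.succ) s := rfl

/-- **Cost of a list walk read off a vertex sequence.**  If `y` follows present edges of `g`, the list walk
`[y 1, …, y T]` from `y 0` has `walkCost = ↑(walkCostFin)`. -/
theorem walkCost_ofFn (θ : ℤ) : ∀ (g : List (WLayer V K)) (y : Fin (g.length + 1) → V),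
    (∀ s : Fin g.length, (edgeAt g.get y s).isSome) →
    walkCost d θ g (y 0) (List.ofFn fun s : Fin g.length => y s.succ) = ((walkCostFin d g.get θ y : ℤ) : WithTop ℤ)
  | [], y, _ => by
      simp only [List.length_nil, List.ofFn_zero, walkCost_nil_nil, walkCostFin, Finset.univ_eq_empty,
        Finset.sum_empty, WithTop.coe_zero]
  | l :: g, y, h => by
      obtain ⟨e, he⟩ := Option.isSome_iff_exists.mp (h 0)
      have he' : l (y 0) (y 1) = some e := by rw [← edgeAt_cons_zero l g y]; exact he
      have ih := walkCost_ofFn θ g (fun t => y t.succ) (fun s => by rw [← edgeAt_cons_succ l g y s]; exact h s.succ)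
      simp only [Fin.succ_zero_eq_one] at ih
      have hF : walkCostFin d (l :: g).get θ y = (e.a - θ * (d e.cls : ℤ)) + walkCostFin d g.get θ (fun t => y t.succ) := by
        unfold walkCostFin
        refine (Fin.sum_univ_succ _).trans ?_
        simp only [edgeAt_cons_zero, he', edgeAt_cons_succ]
      rw [List.ofFn_succ, walkCost_cons_cons]
      simp only [Fin.succ_zero_eq_one]
      rw [he', ih, hF]
      simp only [stepCost]
      push_cast
      rfl

/-- **Sign of a list walk read off a vertex sequence.** -/
theorem walkSign_ofFn : ∀ (g : List (WLayer V K)) (y : Fin (g.length + 1) → V),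
    walkSign g (y 0) (List.ofFn fun s : Fin g.length => y s.succ) = walkSgnFin g.get y
  | [], y => by
      simp only [List.length_nil, List.ofFn_zero, walkSign_nil, walkSgnFin, Finset.univ_eq_empty, Finset.prod_empty]
  | l :: g, y => by
      have ih := walkSign_ofFn g (fun t => y t.succ)
      simp only [Fin.succ_zero_eq_one] at ih
      rw [List.ofFn_succ, walkSign_cons_cons]
      simp only [Fin.succ_zero_eq_one]
      rw [ih]
      symm
      unfold walkSgnFin
      refine (Fin.prod_univ_succ _).trans ?_
      simp only [edgeAt_cons_zero, edgeAt_cons_succ]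
      all_goals (cases l (y 0) (y 1) <;> rfl)

/-- **A list walk of finite cost comes from a vertex sequence through present edges.** -/
theorem exists_walk_of_walkCost_ne_top (θ : ℤ) : ∀ (g : List (WLayer V K)) (v : V) (w : List V),
    walkCost d θ g v w ≠ ⊤ →
    ∃ y : Fin (g.length + 1) → V, y 0 = v ∧ (∀ s : Fin g.length, (edgeAt g.get y s).isSome) ∧
      (List.ofFn fun s : Fin g.length => y s.succ) = w
  | [], v, [], _ => ⟨fun _ => v, rfl, fun s => s.elim0, by simp⟩
  | [], _, _ :: _, h => by simp at h
  | _ :: _, _, [], h => by simp at h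
  | l :: g, v, v' :: w, h => by
      rw [walkCost_cons_cons, WithTop.add_ne_top] at h
      obtain ⟨y', hy0, hys, hyw⟩ := exists_walk_of_walkCost_ne_top θ g v' w h.2
      have hl : (l v v').isSome := by
        cases hlv : l v v' with
        | none => exfalso; apply h.1; unfold stepCost; rw [hlv]
        | some e => rfl
      refine ⟨Fin.cons v y', rfl, fun s => ?_, ?_⟩
      · refine Fin.cases ?_ (fun s => ?_) s
        · rw [edgeAt_cons_zero]
          simp only [Fin.cons_zero, Fin.cons_one, hy0]
          exact hl
        · rw [edgeAt_cons_succ]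
          simp only [Fin.cons_succ]
          exact hys s
      · rw [List.ofFn_succ]
        simp only [Fin.cons_succ, Fin.succ_zero_eq_one, Fin.cons_one]
        rw [hy0, ← hyw]

/-! ## 2. Entries of the walk design are in `{−1, 0, 1}` -/

/-- the walk design has entries of absolute value `≤ 1`. -/
theorem natAbs_walkEpsP_le_one [DecidableEq V] {T : ℕ} (lay : Fin T → V → V → Option (WEdge K)) (l₀ : Fin K) (v₀ : V)
    (r c : Fin (T + 1) × V) (l : Fin K) : (walkEpsP lay l₀ v₀ r c l).natAbs ≤ 1 := by
  unfold walkEpsP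
  by_cases hrc : r = c
  · rw [if_pos hrc]; split_ifs <;> simp
  · rw [if_neg hrc]
    cases layerEdge lay r c with
    | some e =>
      simp only
      split_ifs
      · unfold WEdge.sgn; split_ifs <;> simp
      · simp
    | none =>
      simp only
      split_ifs <;> simp

/-! ## 3. The bridge: a unique-walk system gives a long dominant alternating chain -/

section Bridge

variable [Fintype V] [DecidableEq V]

omit [Fintype V] [DecidableEq V] in
/-- two vertex sequences with the same start and the same list of later vertices are equal. -/
theorem eq_of_ofFn_eq {T : ℕ} {y y' : Fin (T + 1) → V} (h0 : y 0 = y' 0)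
    (h : (List.ofFn fun s : Fin T => y s.succ) = List.ofFn fun s : Fin T => y' s.succ) : y = y' := by
  have h1 := List.ofFn_injective h
  funext t
  refine Fin.cases h0 (fun s => ?_) t
  exact congr_fun h1 s

/-- **The bridge.**  Let `g` be a layered graph with `T ≥ 1` layers on a finite vertex type, `v₀` a start vertex, and
suppose given, for `j ≤ N`, strictly increasing integer slopes `lam j`, list walks `w_j` with `walkCost = c_j`, every other
list costing at least `c_j + 1` at slope `lam j`, and `walkSign w_j = (−1)^j`.  Then the walk design of `g` (format
`(T+1)·|V|`, the same `K` classes) carries a sign-alternating dominant chain of `N + 1` terms, so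
`TropRootLawAt ((T+1)·|V|) K B → N ≤ B`. -/
theorem le_of_walkSystem (hK : 0 < K) (g : List (WLayer V K)) (hT : 0 < g.length) (v₀ : V) {N : ℕ}
    (lam : Fin (N + 1) → ℤ) (hlam : StrictMono lam) (wstar : Fin (N + 1) → List V) (c : Fin (N + 1) → ℤ)
    (hcost : ∀ j, walkCost d (lam j) g v₀ (wstar j) = ((c j : ℤ) : WithTop ℤ))
    (hmarg : ∀ j (w : List V), w ≠ wstar j → ((c j + 1 : ℤ) : WithTop ℤ) ≤ walkCost d (lam j) g v₀ w)
    (hsign : ∀ j, walkSign g v₀ (wstar j) = (-1) ^ (j : ℕ))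
    (B : ℕ) (hrow : TropRootLawAt ((g.length + 1) * Fintype.card V) K B) : N ≤ B := by
  classical
  set T := g.length with hTdef
  set lay : Fin T → V → V → Option (WEdge K) := g.get with hlay
  set l₀ : Fin K := ⟨0, hK⟩ with hl₀
  -- the index equivalence
  set ι : Fin (T + 1) × V ≃ Fin ((T + 1) * Fintype.card V) :=
    (Equiv.prodCongr (Equiv.refl (Fin (T + 1))) (Fintype.equivFin V)).trans finProdFinEquiv with hι
  -- the vertex sequences of the dedicated walks
  have hne : ∀ j, walkCost d (lam j) g v₀ (wstar j) ≠ ⊤ := fun j => by rw [hcost]; exact WithTop.coe_ne_top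
  choose y hy0 hys hyw using fun j => exists_walk_of_walkCost_ne_top d (lam j) g v₀ (wstar j) (hne j)
  have hwalk : ∀ j, IsLayWalk lay v₀ (y j) := fun j => ⟨hy0 j, hys j⟩
  have hcostFin : ∀ j, walkCostFin d lay (lam j) (y j) = c j := by
    intro j
    have h1 := walkCost_ofFn d (lam j) g (y j) (hys j)
    rw [hy0 j, hyw j, hcost j] at h1
    exact (WithTop.coe_eq_coe.mp h1).symm
  have hsgnFin : ∀ j, walkSgnFin lay (y j) = (-1) ^ (j : ℕ) := by
    intro j
    have h1 := walkSign_ofFn g (y j)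
    rw [hy0 j, hyw j, hsign j] at h1
    exact h1.symm
  -- the bonus beating the identity term
  set Ω : ℤ := 1 + ∑ j, (|c j| + (T : ℤ) * |lam j| * (d l₀ : ℤ)) with hΩ
  have hΩj : ∀ j, walkCostFin d lay (lam j) (y j) + (T : ℤ) * (lam j * (d l₀ : ℤ)) < Ω := by
    intro j
    rw [hcostFin]
    have h1 : |c j| + (T : ℤ) * |lam j| * (d l₀ : ℤ) ≤ ∑ j, (|c j| + (T : ℤ) * |lam j| * (d l₀ : ℤ)) :=
      Finset.single_le_sum (f := fun j => |c j| + (T : ℤ) * |lam j| * (d l₀ : ℤ))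
        (fun i _ => by positivity) (mem_univ j)
    have h2 : c j ≤ |c j| := le_abs_self _
    have h3 : (T : ℤ) * (lam j * (d l₀ : ℤ)) ≤ (T : ℤ) * |lam j| * (d l₀ : ℤ) := by
      have : lam j * (d l₀ : ℤ) ≤ |lam j| * (d l₀ : ℤ) :=
        mul_le_mul_of_nonneg_right (le_abs_self _) (by positivity)
      nlinarith
    omega
  -- the chain
  set p : Fin (N + 1) → Equiv.Perm (Fin ((T + 1) * Fintype.card V)) × (Fin ((T + 1) * Fintype.card V) → Fin K) :=
    fun j => walkTerm ι lay l₀ (y j) with hp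
  refine hrow d (walkVal ι lay Ω v₀) (walkEps ι lay l₀ v₀) N lam p ?_ hlam ?_ ?_
  · intro a b l
    exact natAbs_walkEpsP_le_one lay l₀ v₀ _ _ l
  · intro j
    refine isDominant_walkTerm lay l₀ v₀ ι d Ω (lam j) hT (hwalk j) (hΩj j) fun y' hy' hne' => ?_
    -- a competitor walk is a competitor list
    have hw' : (List.ofFn fun s : Fin T => y' s.succ) ≠ wstar j := by
      intro h
      apply hne'
      exact eq_of_ofFn_eq (hy'.1.trans (hy0 j).symm) (h.trans (hyw j).symm)
    have h1 := hmarg j _ hw'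
    rw [← hy'.1, walkCost_ofFn d (lam j) g y' hy'.2] at h1
    · rw [hcostFin]
      have := WithTop.coe_le_coe.mp h1
      exact this
  · intro j
    rw [alternate_walkTerm_iff lay l₀ v₀ ι hT (hwalk _) (hwalk _), hsgnFin, hsgnFin]
    simp only [Fin.val_castSucc, Fin.val_succ, pow_succ]
    have : ((-1 : ℤ) ^ (j : ℕ)) * ((-1 : ℤ) ^ (j : ℕ)) = 1 := by rw [← mul_pow]; norm_num
    nlinarith

end Bridge

/-! ## 4. The staircase: `TropExponentLaw e` fails for every `e` -/

/-- **The staircase lower bound in the tropical census.**  For `n ≥ 2` even and `L ≥ 1`, the format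
`m = ((2^L − 1)(n+1) + 1)·(2^L·n·2)` with `K = L + 1` classes has a sign-alternating dominant chain with `n^L − 1`
breakpoints: `TropRootLawAt m (L+1) B → n^L − 1 ≤ B`. [folklore, from the tree's `DPR.stub_stair`] -/
theorem staircase_lower (n L : ℕ) (hn : 2 ≤ n) (he : Even n) (hL : 1 ≤ L) (B : ℕ)
    (h : TropRootLawAt (((2 ^ L - 1) * (n + 1) + 1) * (2 ^ L * n * 2)) (L + 1) B) : n ^ L - 1 ≤ B := by
  classical
  have hN : n ^ L - 1 + 1 = n ^ L := Nat.sub_add_cancel (Nat.one_le_pow _ _ (by omega))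
  obtain ⟨g, d, v₀, lam, wstar, c, hlen, hlam, hcost, hmarg, hsign⟩ := stub_stair n L (n ^ L - 1) hn he hL hN
  have hT : 0 < g.length := by
    rw [hlen]
    have : 1 ≤ 2 ^ L - 1 := by
      have : 2 ≤ 2 ^ L := by
        calc 2 = 2 ^ 1 := by norm_num
          _ ≤ 2 ^ L := Nat.pow_le_pow_right (by norm_num) hL
      omega
    positivity
  have hcard : Fintype.card (Fin (2 ^ L * n) × Bool) = 2 ^ L * n * 2 := by
    rw [Fintype.card_prod, Fintype.card_fin, Fintype.card_bool]
  have hrow : TropRootLawAt ((g.length + 1) * Fintype.card (Fin (2 ^ L * n) × Bool)) (L + 1) B := by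
    rw [hcard, hlen]; exact h
  exact le_of_walkSystem d (Nat.succ_pos L) g hT v₀ lam hlam wstar c hcost hmarg hsign B hrow

/-- the staircase format is at most `2^(2L+2)·n²`. -/
theorem staircase_format_le (n L : ℕ) (hn : 1 ≤ n) :
    ((2 ^ L - 1) * (n + 1) + 1) * (2 ^ L * n * 2) ≤ 2 ^ (2 * L + 2) * n ^ 2 := by
  have h1 : (2 ^ L - 1) * (n + 1) + 1 ≤ 2 ^ L * (2 * n) := by
    have h2 : 1 ≤ 2 ^ L := Nat.one_le_two_pow
    have : (2 ^ L - 1) * (n + 1) + 1 ≤ 2 ^ L * (n + 1) := by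
      have := Nat.sub_le (2 ^ L) 1
      calc (2 ^ L - 1) * (n + 1) + 1 ≤ (2 ^ L - 1) * (n + 1) + (n + 1) := by omega
        _ = (2 ^ L - 1 + 1) * (n + 1) := by ring
        _ = 2 ^ L * (n + 1) := by rw [Nat.sub_add_cancel h2]
    calc (2 ^ L - 1) * (n + 1) + 1 ≤ 2 ^ L * (n + 1) := this
      _ ≤ 2 ^ L * (2 * n) := Nat.mul_le_mul_left _ (by omega)
  calc ((2 ^ L - 1) * (n + 1) + 1) * (2 ^ L * n * 2) ≤ (2 ^ L * (2 * n)) * (2 ^ L * n * 2) :=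
        Nat.mul_le_mul_right _ h1
    _ = 2 ^ (2 * L + 2) * n ^ 2 := by ring

/-- **`TropExponentLaw e` is false for every `e`** (kernel form of the route's paper-level «TE is dead»): no bound of the
shape `2^{CK}·m^e`, `e` uniform in `K`, holds for the tropical census — the staircase with `L = 2e + 1` (`K = 2e + 2`)
has `n^{2e+1} − 1` breakpoints on `≤ 2^{4e+4}·n²` nodes. [folklore, from `staircase_lower`] -/
theorem not_tropExponentLaw (e : ℕ) : ¬ TropExponentLaw e := by
  rintro ⟨C, hC⟩
  set L := 2 * e + 1 with hL
  set A := 2 ^ (C * (L + 1)) * (2 ^ (2 * L + 2)) ^ e with hA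
  set n := 2 * A + 2 with hn
  have hn2 : 2 ≤ n := by omega
  have hne : Even n := ⟨A + 1, by omega⟩
  set m := ((2 ^ L - 1) * (n + 1) + 1) * (2 ^ L * n * 2) with hm
  have h1 := staircase_lower n L hn2 hne (by omega) _ (hC m (L + 1))
  -- `2^{C(L+1)}·m^e ≤ A·n^{2e}`
  have hm' : m ≤ 2 ^ (2 * L + 2) * n ^ 2 := staircase_format_le n L (by omega)
  have h2 : 2 ^ (C * (L + 1)) * m ^ e ≤ A * n ^ (2 * e) := by
    calc 2 ^ (C * (L + 1)) * m ^ e ≤ 2 ^ (C * (L + 1)) * (2 ^ (2 * L + 2) * n ^ 2) ^ e :=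
          Nat.mul_le_mul_left _ (Nat.pow_le_pow_left hm' e)
      _ = A * n ^ (2 * e) := by rw [hA, mul_pow, ← pow_mul]; ring
  -- `n^L = n^{2e}·n ≥ n^{2e}·(A + 2)`
  have h3 : n ^ L = n ^ (2 * e) * n := by rw [hL, pow_succ]
  have h4 : 1 ≤ n ^ (2 * e) := Nat.one_le_pow _ _ (by omega)
  have h5 : n ^ L - 1 ≤ A * n ^ (2 * e) := h1.trans h2
  rw [h3] at h5
  have : n ^ (2 * e) * n ≤ A * n ^ (2 * e) + 1 := by omega
  nlinarith

/-- **`TropK4Law 1` is false**: the `K = 4` column of the tropical census is not linearly bounded — the staircase with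
`L = 3` has `n³ − 1` breakpoints on `≤ 256·n²` nodes (so `T(m, 4) ≥ c·m^{3/2}`). [folklore, from `staircase_lower`] -/
theorem not_tropK4Law_one : ¬ TropK4Law 1 := by
  rintro ⟨C, hC⟩
  set A := C * 257 with hA
  set n := 2 * A + 2 with hn
  have hn2 : 2 ≤ n := by omega
  have hne : Even n := ⟨A + 1, by omega⟩
  set m := ((2 ^ 3 - 1) * (n + 1) + 1) * (2 ^ 3 * n * 2) with hm
  have h1 := staircase_lower n 3 hn2 hne (by norm_num) _ (hC m)
  have hm' : m ≤ 2 ^ (2 * 3 + 2) * n ^ 2 := staircase_format_le n 3 (by omega)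
  have h2 : C * (m + 1) ^ 1 ≤ A * n ^ 2 := by
    rw [pow_one]
    have : m + 1 ≤ 257 * n ^ 2 := by
      have : 1 ≤ n ^ 2 := Nat.one_le_pow _ _ (by omega)
      norm_num at hm'
      omega
    calc C * (m + 1) ≤ C * (257 * n ^ 2) := Nat.mul_le_mul_left _ this
      _ = A * n ^ 2 := by rw [hA]; ring
  have h3 : n ^ 3 = n ^ 2 * n := by ring
  have h4 : 1 ≤ n ^ 2 := Nat.one_le_pow _ _ (by omega)
  have h5 : n ^ 3 - 1 ≤ A * n ^ 2 := h1.trans h2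
  rw [h3] at h5
  have : n ^ 2 * n ≤ A * n ^ 2 + 1 := by omega
  nlinarith

end Summit.ValiantsHypothesis.ValiantsHypothesis.Theorems.KPlusLogSqLaw.WalkDesign
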